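import Mathlib
import Summits.Ventures.HodgeRepro2.T6N5FockLiHyp
import Summits.Ventures.HodgeRepro2.T6N5FockSmooth

/-!
# T6N5FockLiMain — the conjugate-orthogonal Fock dictionary and condition (b) at the real places from Li 1990 (32)
BY NAME: the (C)-form of the real-place chain (route/T6-N5-t6-p7.md §14(l)) — Tier 6, M2 sub-step N5 (t6-p7),
proof lane

The accepted chain (T6N5FockCarrier p411341 → T6N5FockHyp p412663 → T6N5FockMain p412347 → T6N5FockBundle p413410
→ T6N5FockSmooth p419245) takes the K-type half-line statement at lines from the display
`Hyp.KonnoKonno2007_Thm5_4_i_lines` (PRINT PENDING W-11).  This file derives the SAME half-line statement — up to a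
DIRECTION UNIT `e` — from the display `Hyp.Li1990_eq32_lines` on Li's carrier (deposited journal print) through ONE
EX identification, `LiBridge C L e`: «the KK07 occurrence predicate at (sV, sW, εψ, l) is Li's at
(sV, e·εψ·sW, −l)» (the ξ-split normalisation at the character ψ against Li's half-integral one: the sign label
of the second line and the weight are matched up to the universal unit `e` that Li's unnamed additive character
and skew-hermitian convention leave free — never a claim about print).  `KTypeHalfLineD C e` is `KTypeHalfLine C`
at `e = 1` (`kTypeHalfLineD_one_iff`); `fockDictCO_of_carrier_D` is `fockDictCO_of_carrier` with the calibration
`e·εψ·sW = −1`; `fockDictCO_of_carrier_Li` / `fockDictCO_of_displays_Li` consume the Li display and KK07 Fact 5.1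
BY NAME; `RealPlaceBundleLi` is `RealPlaceBundle` with the Li carriers, the units and the bridge facts as declared
EX fields, and `SignModel.realCondB_of_bundleLi_smooth` is the (b)-binder of a v8 in this form (the restricted
Epsilon-Dichotomy display of record v2, t6-p8 p416876).  Non-vacuity: `Toy.liCarrier` (the half-line rule),
`Toy.carrier_liBridge` (the accepted half-line carrier IS bridged to it at `e = 1`), `Toy.bundleLi`,
`Toy.bundleLi_joint_smooth`, `Toy.toySign_eq_bundleLi`.  Nothing accepted changes; no KK07 Theorem 5.4(i)
display is consumed anywhere in this file.  Count: per real place and side, PO 2 (Li (32), KK07 Fact 5.1) +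
EX 3 (`hT`, `hbr`, `hcal`) + data (`C`, `L`, `e`, `sW`, `εψ`) — one EX binder and one datum more than the (B) form,
the PO print-complete.
§8(d): uses an L-value-free non-vanishing device: NO.
-/

namespace Summit.Ventures.HodgeRepro2.T6.N5Fock

open Summit.Ventures.HodgeRepro2.T6.N5LocalDatum Summit.Ventures.HodgeRepro2.T6.Hyp
  Summit.Ventures.HodgeRepro2.T6.N5RealPlace Summit.Ventures.HodgeRepro2.T6.N5Rich

/-- THE K-TYPE HALF-LINE STATEMENT WITH A DIRECTION UNIT `e`: the occurrence set is `{l ≤ 0}` when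
`e·εψ·sV·sW = 1` and `{l ≥ 1}` when `e·εψ·sV·sW = −1`; at `e = 1` this is `KTypeHalfLine`. -/
def KTypeHalfLineD (C : KTypeCarrier) (e : ℤˣ) : Prop :=
  ∀ (sV sW εψ : ℤˣ) (l : ℤ), C.occ sV sW εψ l ↔
    ((e * εψ * sV * sW = 1 → l ≤ 0) ∧ (e * εψ * sV * sW = -1 → 1 ≤ l))

/-- At the unit `e = 1` the directed statement is the accepted `KTypeHalfLine`. -/
theorem kTypeHalfLineD_one_iff (C : KTypeCarrier) : KTypeHalfLineD C 1 ↔ KTypeHalfLine C := by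
  unfold KTypeHalfLineD KTypeHalfLine
  simp only [one_mul]

/-- THE BRIDGE (EX class; the §14(l) identification): the KK07 occurrence predicate of the carrier `C` at
(sV, sW, εψ, l) — the ξ-split normalisation at the additive character of sign `εψ`, the skew-hermitian line of
sign `sW`, the b_{V,ψ}-highest weight `l` — is Li's occurrence predicate of `L` at (sV, e·εψ·sW, −l): the second
line's label and the weight are matched up to the universal unit `e` (Li names neither his additive character nor
the skew-hermitian sign convention).  Never a claim about print. -/
def LiBridge (C : KTypeCarrier) (L : LiLineCarrier) (e : ℤˣ) : Prop :=
  ∀ (sV sW εψ : ℤˣ) (l : ℤ), C.occ sV sW εψ l ↔ L.occ sV (e * εψ * sW) (-l)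

/-- THE HALF-LINE STATEMENT AT LINES FROM LI (32) THROUGH THE BRIDGE: Li's half-lines `{w ≥ 0}` / `{w < 0}` at
`w = −l` are `{l ≤ 0}` / `{l ≥ 1}`, assigned by the sign `e·εψ·sV·sW`. -/
theorem kTypeHalfLineD_of_Li (C : KTypeCarrier) (L : LiLineCarrier) (e : ℤˣ) (hbr : LiBridge C L e)
    (hLi : Li1990_eq32_lines L) : KTypeHalfLineD C e := by
  intro sV sW εψ l
  rw [hbr, hLi]
  have h : sV * (e * εψ * sW) = e * εψ * sV * sW := by
    rcases Int.units_eq_one_or sV with rfl | rfl <;> rcases Int.units_eq_one_or e with rfl | rfl <;>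
      rcases Int.units_eq_one_or εψ with rfl | rfl <;> rcases Int.units_eq_one_or sW with rfl | rfl <;> decide
  rw [h]
  constructor
  · rintro ⟨h1, h2⟩
    exact ⟨fun hh => by have := h1 hh; omega, fun hh => by have := h2 hh; omega⟩
  · rintro ⟨h1, h2⟩
    exact ⟨fun hh => by have := h1 hh; omega, fun hh => by have := h2 hh; omega⟩

/-- `fockDictCO_of_carrier` WITH THE DIRECTION UNIT: the calibration reads `e·εψ·sW = −1`. -/
theorem fockDictCO_of_carrier_D (R : RealData) (C : KTypeCarrier) (e sW εψ : ℤˣ)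
    (hcal : e * εψ * sW = -1) (hodd : Odd R.mA')
    (hT : ∀ s w, R.Theta s w ↔ thetaOf C sW εψ R.mA' s w)
    (hK : KTypeHalfLineD C e) (hH : HoweCompact C) : R.FockDictCO := by
  intro s χ
  rw [hT]
  unfold thetaOf
  rw [hH, hK, toAdd_ofAdd]
  obtain ⟨n, hn⟩ := hodd
  rw [hn, kkWeight_even]
  rcases Int.units_eq_one_or s with hs | hs <;> rcases Int.units_eq_one_or e with he' | he' <;>
    rcases Int.units_eq_one_or εψ with he | he <;> rcases Int.units_eq_one_or sW with hw | hw <;>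
    subst hs he' he hw <;> simp at hcal ⊢ <;> omega

/-- THE CONJUGATE-ORTHOGONAL FOCK DICTIONARY ON THE CARRIER FROM LI (32): the bridge, the Li display and the
compact Howe duality (KK07 Fact 5.1) give `FockDictCO` — no KK07 Theorem 5.4(i) statement is used. -/
theorem fockDictCO_of_carrier_Li (R : RealData) (C : KTypeCarrier) (L : LiLineCarrier) (e sW εψ : ℤˣ)
    (hcal : e * εψ * sW = -1) (hodd : Odd R.mA')
    (hT : ∀ s w, R.Theta s w ↔ thetaOf C sW εψ R.mA' s w)
    (hbr : LiBridge C L e) (hLi : Li1990_eq32_lines L) (hH : HoweCompact C) : R.FockDictCO :=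
  fockDictCO_of_carrier_D R C e sW εψ hcal hodd hT (kTypeHalfLineD_of_Li C L e hbr hLi) hH

/-- The same FROM THE DISPLAYS BY NAME: `Hyp.Li1990_eq32_lines` and `Hyp.KonnoKonno2007_Fact5_1_compact`. -/
theorem fockDictCO_of_displays_Li (R : RealData) (C : KTypeCarrier) (L : LiLineCarrier) (e sW εψ : ℤˣ)
    (hcal : e * εψ * sW = -1) (hodd : Odd R.mA')
    (hT : ∀ s w, R.Theta s w ↔ thetaOf C sW εψ R.mA' s w)
    (hbr : LiBridge C L e) (hLi : Li1990_eq32_lines L) (h51 : KonnoKonno2007_Fact5_1_compact C) :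
    R.FockDictCO :=
  fockDictCO_of_carrier_Li R C L e sW εψ hcal hodd hT hbr hLi h51

/-- THE REAL-PLACE BUNDLE IN THE (C) FORM: `RealPlaceBundle` with, per place and side, Li's carrier, the
direction unit and the bridge fact as declared EX fields; the calibration carries the unit.  Data and declared
facts only — the displays are binders of `SignModel.realCondB_of_bundleLi`. -/
structure RealPlaceBundleLi (ι : Type*) where
  /-- the real-place data of side A at each place (used at the real places) -/
  RA : ι → RealData
  /-- the real-place data of side B at each place -/
  RB : ι → RealData
  /-- the KK07 K-type carrier of side A at each place -/
  CA : ι → KTypeCarrier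
  /-- the KK07 K-type carrier of side B at each place -/
  CB : ι → KTypeCarrier
  /-- Li's K̃-type carrier of side A at each place -/
  LA : ι → LiLineCarrier
  /-- Li's K̃-type carrier of side B at each place -/
  LB : ι → LiLineCarrier
  /-- the sign of the skew-hermitian line W of side A at each place -/
  sWA : ι → ℤˣ
  /-- the sign of the skew-hermitian line W of side B at each place -/
  sWB : ι → ℤˣ
  /-- the sign ε_ψ of the additive character at each place, side A -/
  εψA : ι → ℤˣ
  /-- the sign ε_ψ of the additive character at each place, side B -/
  εψB : ι → ℤˣ
  /-- the direction unit of the bridge, side A (EX) -/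
  eA : ι → ℤˣ
  /-- the direction unit of the bridge, side B (EX) -/
  eB : ι → ℤˣ
  /-- the calibration with the unit, e · ε_ψ · sW = −1 (EX), side A -/
  hcalA : ∀ v, eA v * εψA v * sWA v = -1
  /-- the calibration with the unit, side B -/
  hcalB : ∀ v, eB v * εψB v * sWB v = -1
  /-- m′_A is odd (the weight of the splitting character; EX), side A -/
  hoddA : ∀ v, Odd (RA v).mA'
  /-- m′_A is odd, side B -/
  hoddB : ∀ v, Odd (RB v).mA'
  /-- the theta predicate of side A is read off the KK07 carrier (EX: the §10.2 identification) -/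
  hTA : ∀ v s w, (RA v).Theta s w ↔ thetaOf (CA v) (sWA v) (εψA v) (RA v).mA' s w
  /-- the theta predicate of side B is read off the KK07 carrier -/
  hTB : ∀ v s w, (RB v).Theta s w ↔ thetaOf (CB v) (sWB v) (εψB v) (RB v).mA' s w
  /-- the bridge between the KK07 carrier and Li's carrier (EX: the §14(l) identification), side A -/
  hbrA : ∀ v, LiBridge (CA v) (LA v) (eA v)
  /-- the bridge, side B -/
  hbrB : ∀ v, LiBridge (CB v) (LB v) (eB v)
  /-- the half-line inequalities of the torus weights, side A (the VERDICT's weights; EX / kernel) -/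
  hHA : ∀ v i, (RA v).HalfLine i
  /-- the half-line inequalities, side B -/
  hHB : ∀ v i, (RB v).HalfLine i

namespace RealPlaceBundleLi

variable {ι : Type*} (B : RealPlaceBundleLi ι)

/-- The sign model with the bundle's real-place signs over the finite data `kind` / `D` / `ξ`. -/
def signModel (kind : ι → PlaceKind) (D : ι → LocalSignDatum) (ξ : ∀ v, Fin 4 → (D v).Char) :
    SignModel ι :=
  SignModel.ofReal kind D ξ B.RA B.RB

/-- The conjugate-orthogonal Fock dictionary of side A at a place from the Li display on its Li carrier and
KK07 Fact 5.1 on its KK07 carrier. -/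
theorem fockDictCO_A (v : ι) (hLi : Li1990_eq32_lines (B.LA v))
    (h51 : KonnoKonno2007_Fact5_1_compact (B.CA v)) : (B.RA v).FockDictCO :=
  fockDictCO_of_displays_Li (B.RA v) (B.CA v) (B.LA v) (B.eA v) (B.sWA v) (B.εψA v) (B.hcalA v) (B.hoddA v)
    (B.hTA v) (B.hbrA v) hLi h51

/-- The same on side B. -/
theorem fockDictCO_B (v : ι) (hLi : Li1990_eq32_lines (B.LB v))
    (h51 : KonnoKonno2007_Fact5_1_compact (B.CB v)) : (B.RB v).FockDictCO :=
  fockDictCO_of_displays_Li (B.RB v) (B.CB v) (B.LB v) (B.eB v) (B.sWB v) (B.εψB v) (B.hcalB v) (B.hoddB v)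
    (B.hTB v) (B.hbrB v) hLi h51

end RealPlaceBundleLi

end Summit.Ventures.HodgeRepro2.T6.N5Fock

namespace Summit.Ventures.HodgeRepro2.T6.N5Rich.SignModel

open Summit.Ventures.HodgeRepro2.T6.N5LocalDatum Summit.Ventures.HodgeRepro2.T6.N5Rich
  Summit.Ventures.HodgeRepro2.T6.Hyp Summit.Ventures.HodgeRepro2.T6.N5RealPlace
  Summit.Ventures.HodgeRepro2.T6.N5Fock

/-- CONDITION (b) AT THE REAL PLACES OF A SIGN MODEL FROM THE (C)-FORM BUNDLE AND THE DISPLAYS BY NAME: the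
Epsilon Dichotomy on the real-place instances of both sides, Li (32) on the Li carriers and KK07 Fact 5.1 on the
KK07 carriers at the real places give `S.RealCondB`. -/
theorem realCondB_of_bundleLi {ι : Type*} (S : SignModel ι) (B : RealPlaceBundleLi ι)
    (hS : S = B.signModel S.kind S.D S.ξ)
    (h35A : ∀ v, S.kind v = .re → BFGYYZ2025_Thm3_5 (B.RA v).toLocal)
    (h35B : ∀ v, S.kind v = .re → BFGYYZ2025_Thm3_5 (B.RB v).toLocal)
    (hLiA : ∀ v, S.kind v = .re → Li1990_eq32_lines (B.LA v))
    (hLiB : ∀ v, S.kind v = .re → Li1990_eq32_lines (B.LB v))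
    (h51A : ∀ v, S.kind v = .re → KonnoKonno2007_Fact5_1_compact (B.CA v))
    (h51B : ∀ v, S.kind v = .re → KonnoKonno2007_Fact5_1_compact (B.CB v)) :
    S.RealCondB := by
  rw [hS]
  exact realCondB_ofReal_CO S.kind S.D S.ξ B.RA B.RB h35A h35B
    (fun v hv => B.fockDictCO_A v (hLiA v hv) (h51A v hv))
    (fun v hv => B.fockDictCO_B v (hLiB v hv) (h51B v hv))
    (fun v _ i => B.hHA v i) (fun v _ i => B.hHB v i)

/-- The same with the Epsilon Dichotomy in t6-p8's RESTRICTED form (the statements of record v2): the (b)-binder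
of a v8 in the (C) form. -/
theorem realCondB_of_bundleLi_smooth {ι : Type*} (S : SignModel ι) (B : RealPlaceBundleLi ι)
    (hS : S = B.signModel S.kind S.D S.ξ)
    (h35A : ∀ v, S.kind v = .re → BFGYYZ2025_Thm3_5_smooth (B.RA v).toLocal (fun _ => True))
    (h35B : ∀ v, S.kind v = .re → BFGYYZ2025_Thm3_5_smooth (B.RB v).toLocal (fun _ => True))
    (hLiA : ∀ v, S.kind v = .re → Li1990_eq32_lines (B.LA v))
    (hLiB : ∀ v, S.kind v = .re → Li1990_eq32_lines (B.LB v))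
    (h51A : ∀ v, S.kind v = .re → KonnoKonno2007_Fact5_1_compact (B.CA v))
    (h51B : ∀ v, S.kind v = .re → KonnoKonno2007_Fact5_1_compact (B.CB v)) :
    S.RealCondB :=
  S.realCondB_of_bundleLi B hS (fun v hv => thm3_5_of_smooth_true _ (h35A v hv))
    (fun v hv => thm3_5_of_smooth_true _ (h35B v hv)) hLiA hLiB h51A h51B

end Summit.Ventures.HodgeRepro2.T6.N5Rich.SignModel

namespace Summit.Ventures.HodgeRepro2.T6.N5Fock

open Summit.Ventures.HodgeRepro2.T6.N5LocalDatum Summit.Ventures.HodgeRepro2.T6.N5Rich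
  Summit.Ventures.HodgeRepro2.T6.Hyp Summit.Ventures.HodgeRepro2.T6.N5RealPlace

/-! ## Non-vacuity (README §10.5(ii)(c)/(d)) -/

namespace Toy

/-- Li's half-line carrier: the occurrence predicate IS the rule of (32) at lines. -/
def liCarrier : LiLineCarrier where
  occ := fun sV s' w => (sV * s' = 1 → 0 ≤ w) ∧ (sV * s' = -1 → w < 0)

/-- Li's half-line carrier satisfies the Li display (definitionally). -/
theorem liCarrier_eq32 : Li1990_eq32_lines liCarrier := fun _ _ _ => Iff.rfl

/-- The accepted half-line carrier of `T6N5FockCarrier` is bridged to Li's at the unit `e = 1`. -/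
theorem carrier_liBridge : LiBridge carrier liCarrier 1 := by
  intro sV sW εψ l
  show ((εψ * sV * sW = 1 → l ≤ 0) ∧ (εψ * sV * sW = -1 → 1 ≤ l)) ↔
    ((sV * (1 * εψ * sW) = 1 → 0 ≤ -l) ∧ (sV * (1 * εψ * sW) = -1 → -l < 0))
  rcases Int.units_eq_one_or sV with rfl | rfl <;> rcases Int.units_eq_one_or εψ with rfl | rfl <;>
    rcases Int.units_eq_one_or sW with rfl | rfl <;> simp <;> omega

/-- The (C)-form bundle over any place set: `toyReal₁` and the two half-line carriers on both sides at every
place, unit `1`. -/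
def bundleLi (ι : Type*) : RealPlaceBundleLi ι where
  RA := fun _ => toyReal₁
  RB := fun _ => toyReal₁
  CA := fun _ => carrier
  CB := fun _ => carrier
  LA := fun _ => liCarrier
  LB := fun _ => liCarrier
  sWA := fun _ => -1
  sWB := fun _ => -1
  εψA := fun _ => 1
  εψB := fun _ => 1
  eA := fun _ => 1
  eB := fun _ => 1
  hcalA := fun _ => by decide
  hcalB := fun _ => by decide
  hoddA := fun _ => ⟨0, by decide⟩
  hoddB := fun _ => ⟨0, by decide⟩
  hTA := fun _ _ _ => Iff.rfl
  hTB := fun _ _ _ => Iff.rfl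
  hbrA := fun _ => carrier_liBridge
  hbrB := fun _ => carrier_liBridge
  hHA := fun _ => toyReal₁_halfLine
  hHB := fun _ => toyReal₁_halfLine

/-- JOINT NON-VACUITY of `realCondB_of_bundleLi_smooth`: on the sign model built on the toy (C)-form bundle every
display binder holds and (b) at the real places follows. -/
theorem bundleLi_joint_smooth {ι : Type*} (kind : ι → PlaceKind) (D : ι → LocalSignDatum)
    (ξ : ∀ v, Fin 4 → (D v).Char) :
    (∀ v, BFGYYZ2025_Thm3_5_smooth ((bundleLi ι).RA v).toLocal (fun _ => True)) ∧
      (∀ v, BFGYYZ2025_Thm3_5_smooth ((bundleLi ι).RB v).toLocal (fun _ => True)) ∧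
      (∀ v, Li1990_eq32_lines ((bundleLi ι).LA v)) ∧
      (∀ v, KonnoKonno2007_Fact5_1_compact ((bundleLi ι).CA v)) ∧
      ((bundleLi ι).signModel kind D ξ).RealCondB :=
  ⟨fun _ => toyReal₁_thm3_5_smooth, fun _ => toyReal₁_thm3_5_smooth, fun _ => liCarrier_eq32,
    fun _ => carrier_howeCompact,
    ((bundleLi ι).signModel kind D ξ).realCondB_of_bundleLi_smooth (bundleLi ι) rfl
      (fun _ _ => toyReal₁_thm3_5_smooth) (fun _ _ => toyReal₁_thm3_5_smooth)
      (fun _ _ => liCarrier_eq32) (fun _ _ => liCarrier_eq32)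
      (fun _ _ => carrier_howeCompact) (fun _ _ => carrier_howeCompact)⟩

/-- t6-p7's accepted rich toy sign model IS the (C)-form bundle's sign model over its finite data — the binder
`hS` of a (C)-form v8 on the (ii)(d) witness `R5 := N5RichToyData.toyRich`. -/
theorem toySign_eq_bundleLi :
    N5RichToyData.toySign = (bundleLi Unit).signModel N5RichToyData.toySign.kind
      N5RichToyData.toySign.D N5RichToyData.toySign.ξ := by
  unfold RealPlaceBundleLi.signModel SignModel.ofReal N5RichToyData.toySign bundleLi toyReal₁
  congr 1 <;> funext v i <;> fin_cases i <;> rfl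

end Toy

end Summit.Ventures.HodgeRepro2.T6.N5Fock
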